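import Literature.Topology.PlaneTopology.Crosscut
import Literature.Probability.RandomPlanarGeometry.PlanarDomains
import HarnessLib

/-!
# Sub-arcs of a Jordan curve through three boundary points; three-marked structures

Topic: Probability / RandomPlanarGeometry (plane topology of `JordanDomain` / `MarkedDomain`).
Elementary facts about the boundary loop of a Jordan domain needed when a `3`-marked structure
`(D; x₀, x₁, x₂)` has to be put on a GIVEN Jordan domain through three GIVEN frontier points, and
its arc `[pt 1, pt 2]` (`MarkedDomain.arc 1`) has to be identified with a given sub-arc of the
boundary curve (e.g. when transporting the splitting form of locality of chordal curve families,
`ChordalFamily.IsTargetIndependent`, to a sub-domain):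

* `eq_image_Icc_of_loop` — in a simple loop `β` (continuous, injective on `[0, 1)`, `β 1 = β 0`)
  a closed connected set `A ⊆ β '' (0, 1)` containing `β tx`, `β ty` and remaining connected after
  removal of either of these two points IS the parameter arc `β '' [min tx ty, max tx ty]`: the
  parameter set of `A` in `(0, 1)` is compact and `β` restricted to it is a closed embedding onto
  `A`, so parameter sets of connected subsets of `A` are intervals, and an endpoint of an arc is
  never an interior parameter (Newman 1939, Ch. IV §5: arcs and simple closed curves);
* `JordanDomain.exists_markedThree` — three distinct frontier points `x₀, x₁, x₂` of a Jordan
  domain are the marked points of a `3`-marked structure on it, with the loop re-based at `x₀`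
  (`mark 0 = 0`, `pt 0 = x₀`) and `{pt 1, pt 2} = {x₁, x₂}`;
* `MarkedDomain.arc_one_eq_of_mark_zero` — for a `3`-marked domain with `mark 0 = 0`, the arc
  `arc 1 = [pt 1, pt 2]` is any closed connected `A ⊆ ∂D ∖ {pt 0}` through `pt 1`, `pt 2` with
  connected `A ∖ {pt 1}` and `A ∖ {pt 2}`; and the arc `[b, b']` of any `3`-marked domain minus an
  endpoint is connected (`MarkedDomain.isPreconnected_arc_one_diff_pt_one / _two`).

Mathlib anchors: `IsPreconnected.preimage_of_isClosedMap`, `Continuous.isClosedMap`,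
`IsPreconnected.Icc_subset`, `Set.OrdConnected.uIcc_subset`, `Set.InjOn.image_sdiff_subset`.
Tree: `JordanDomain`, `MarkedDomain`, `JordanDomain.injOn_boundary_Ico` (PlaneTopology/Crosscut).

## References
* M. H. A. Newman, *Elements of the topology of plane sets of points*, Cambridge (1939), Ch. IV §5.
* W. Werner, *Lectures on two-dimensional critical percolation*, IAS/Park City (2007), §2, §3.2.
-/

noncomputable section

namespace Literature.Probability.RandomPlanarGeometry

open Set _root_.Filter _root_.Topology

/-! ### Sub-arcs of a simple loop -/

/-- **A sub-arc of a simple loop is determined by its endpoints and a missed point.** Let `β` be a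
simple loop (`β 1 = β 0`, injective on `[0, 1)`), `A ⊆ β '' (0, 1)` closed and connected,
containing `β tx` and `β ty` (`tx ≠ ty` in `(0, 1)`) and still connected after removing either of
them. Then `A = β '' [min tx ty, max tx ty]` (Newman 1939, Ch. IV §5). [folklore] -/
theorem eq_image_Icc_of_loop {β : ℝ → ℂ} (hβc : Continuous β) (hβi : InjOn β (Ico 0 1))
    (hβ1 : β 1 = β 0) {A : Set ℂ} (hAc : IsClosed A) (hApre : IsPreconnected A)
    (hAsub : A ⊆ β '' Ioo 0 1) {tx ty : ℝ} (htx : tx ∈ Ioo (0 : ℝ) 1) (hty : ty ∈ Ioo (0 : ℝ) 1)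
    (hne : tx ≠ ty) (hxA : β tx ∈ A) (hyA : β ty ∈ A) (hAx : IsPreconnected (A \ {β tx}))
    (hAy : IsPreconnected (A \ {β ty})) : A = β '' Icc (min tx ty) (max tx ty) := by
  -- reduce to `tx < ty`
  wlog hlt : tx < ty generalizing tx ty
  · have h := this hty htx hne.symm hyA hxA hAy hAx (lt_of_le_of_ne (not_lt.1 hlt) hne.symm)
    rwa [min_comm, max_comm] at h
  rw [min_eq_left hlt.le, max_eq_right hlt.le]
  -- the compact parameter set of `A` inside `(0, 1)`
  set P : Set ℝ := Icc 0 1 ∩ β ⁻¹' A with hP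
  have hPc : IsCompact P := isCompact_Icc.inter_right (hAc.preimage hβc)
  have hPI : P ⊆ Ioo 0 1 := by
    rintro s ⟨hs, hsA⟩
    obtain ⟨s', hs', hs's⟩ := hAsub hsA
    rcases hs.2.eq_or_lt with rfl | hs1
    · rw [hβ1] at hs's
      have := hβi ⟨hs'.1.le, hs'.2⟩ ⟨le_rfl, zero_lt_one⟩ hs's
      exact absurd this hs'.1.ne'
    · have := hβi ⟨hs'.1.le, hs'.2⟩ ⟨hs.1, hs1⟩ hs's
      rw [← this]
      exact hs'
  have hinjP : InjOn β P := fun s hs s' hs' h =>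
    hβi ⟨(hPI hs).1.le, (hPI hs).2⟩ ⟨(hPI hs').1.le, (hPI hs').2⟩ h
  have hmemP : ∀ {s}, s ∈ Ioo (0 : ℝ) 1 → β s ∈ A → s ∈ P := fun hs hsA =>
    ⟨⟨hs.1.le, hs.2.le⟩, hsA⟩
  -- `β` restricted to `P` is a closed embedding onto `A`: parameter sets of connected subsets of
  -- `A` are connected
  have key : ∀ S ⊆ A, IsPreconnected S → IsPreconnected {s | s ∈ P ∧ β s ∈ S} := by
    intro S hSA hS
    haveI : CompactSpace P := isCompact_iff_compactSpace.1 hPc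
    let f : P → ℂ := fun p => β p.1
    have hfc : Continuous f := hβc.comp continuous_subtype_val
    have hfinj : Function.Injective f := fun p p' h => Subtype.ext (hinjP p.2 p'.2 h)
    have hSf : S ⊆ range f := by
      intro x hx
      obtain ⟨s, hs, rfl⟩ := hAsub (hSA hx)
      exact ⟨⟨s, hmemP hs (hSA hx)⟩, rfl⟩
    have h1 : IsPreconnected (f ⁻¹' S) := hS.preimage_of_isClosedMap hfinj hfc.isClosedMap hSf
    have hset : {s | s ∈ P ∧ β s ∈ S} = Subtype.val '' (f ⁻¹' S) := by
      ext s
      constructor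
      · rintro ⟨hs, hsS⟩
        exact ⟨⟨s, hs⟩, hsS, rfl⟩
      · rintro ⟨p, hp, rfl⟩
        exact ⟨p.2, hp⟩
    rw [hset]
    exact h1.image _ continuous_subtype_val.continuousOn
  have hxP : tx ∈ P := hmemP htx hxA
  have hyP : ty ∈ P := hmemP hty hyA
  -- `P` is an interval containing `[tx, ty]`
  have hPpre : IsPreconnected P := by
    have h := key A Subset.rfl hApre
    have hset : {s | s ∈ P ∧ β s ∈ A} = P := by
      ext s
      exact ⟨fun h => h.1, fun h => ⟨h, h.2⟩⟩
    rwa [hset] at h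
  have hIcc : Icc tx ty ⊆ P := hPpre.Icc_subset hxP hyP
  -- an endpoint of `A` is never an interior parameter
  have aux : ∀ {t t' s : ℝ}, t ∈ P → t' ∈ P → s ∈ P → t' ≠ t → s ≠ t →
      IsPreconnected (A \ {β t}) → t ∉ uIcc s t' := by
    intro t t' s ht ht' hs ht't hst hAt htmem
    have hQ := key (A \ {β t}) sdiff_subset hAt
    have hsQ : s ∈ {r | r ∈ P ∧ β r ∈ A \ {β t}} := ⟨hs, hs.2, fun h => hst (hinjP hs ht h)⟩
    have ht'Q : t' ∈ {r | r ∈ P ∧ β r ∈ A \ {β t}} := ⟨ht', ht'.2, fun h => ht't (hinjP ht' ht h)⟩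
    have htQ := hQ.ordConnected.uIcc_subset hsQ ht'Q htmem
    exact htQ.2.2 rfl
  have hlow : ∀ s ∈ P, tx ≤ s := by
    intro s hs
    by_contra hlt'
    rw [not_le] at hlt'
    exact aux hxP hyP hs hne.symm hlt'.ne hAx (mem_uIcc.2 (Or.inl ⟨hlt'.le, hlt.le⟩))
  have hup : ∀ s ∈ P, s ≤ ty := by
    intro s hs
    by_contra hlt'
    rw [not_le] at hlt'
    exact aux hyP hxP hs hne hlt'.ne' hAy (mem_uIcc.2 (Or.inr ⟨hlt.le, hlt'.le⟩))
  -- conclusion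
  apply Subset.antisymm
  · intro x hx
    obtain ⟨s, hs, rfl⟩ := hAsub hx
    have hsP := hmemP hs hx
    exact ⟨s, ⟨hlow s hsP, hup s hsP⟩, rfl⟩
  · rintro _ ⟨s, hs, rfl⟩
    exact (hIcc hs).2

/-! ### Three frontier points of a Jordan domain as a `3`-marked structure -/

/-- **Three distinct frontier points `x₀, x₁, x₂` of a Jordan domain are the marked points of a
`3`-marked structure on it**, with the loop re-based at `x₀` (`mark 0 = 0`, `pt 0 = x₀`) and
`{pt 1, pt 2} = {x₁, x₂}` in the order in which the re-based loop meets them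
(Werner 2007, §2–3: domains with marked boundary points). [folklore] -/
theorem JordanDomain.exists_markedThree (J : JordanDomain) {x₀ x₁ x₂ : ℂ}
    (h₀ : x₀ ∈ frontier J.carrier) (h₁ : x₁ ∈ frontier J.carrier)
    (h₂ : x₂ ∈ frontier J.carrier) (h01 : x₀ ≠ x₁) (h02 : x₀ ≠ x₂) (h12 : x₁ ≠ x₂) :
    ∃ M : MarkedDomain 3, M.carrier = J.carrier ∧ M.mark 0 = 0 ∧ M.pt 0 = x₀ ∧
      ((M.pt 1 = x₁ ∧ M.pt 2 = x₂) ∨ (M.pt 1 = x₂ ∧ M.pt 2 = x₁)) := by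
  -- parameter of `x₀` and the re-based loop
  rw [J.frontier_eq_image_Ico] at h₀
  obtain ⟨u, -, rfl⟩ := h₀
  let J' : JordanDomain :=
    { carrier := J.carrier
      boundary := fun s => J.boundary (s + u)
      isOpen := J.isOpen
      isBounded := J.isBounded
      isConnected := J.isConnected
      continuous_boundary := J.continuous_boundary.comp (continuous_id.add continuous_const)
      periodic_boundary := fun s => by
        show J.boundary (s + 1 + u) = J.boundary (s + u)
        rw [add_right_comm, J.periodic_boundary]
      injOn_boundary := by
        intro s hs s' hs' h
        have h' : J.boundary (s + u) = J.boundary (s' + u) := h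
        have := J.injOn_boundary_Ico u ⟨by linarith [hs.1], by linarith [hs.2]⟩
          ⟨by linarith [hs'.1], by linarith [hs'.2]⟩ h'
        linarith
      range_boundary := by
        rw [← J.range_boundary]
        ext z
        constructor
        · rintro ⟨s, rfl⟩
          exact ⟨s + u, rfl⟩
        · rintro ⟨s, rfl⟩
          exact ⟨s - u, by simp⟩ }
  have hfr : frontier J.carrier = J'.boundary '' Ico 0 1 := J'.frontier_eq_image_Ico
  rw [hfr] at h₁ h₂
  obtain ⟨t₁, ht₁, rfl⟩ := h₁
  obtain ⟨t₂, ht₂, rfl⟩ := h₂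
  have hb0 : J'.boundary 0 = J.boundary u := by
    show J.boundary (0 + u) = J.boundary u
    rw [zero_add]
  have ht₁0 : 0 < t₁ := by
    refine lt_of_le_of_ne ht₁.1 ?_
    rintro rfl
    exact h01 hb0.symm
  have ht₂0 : 0 < t₂ := by
    refine lt_of_le_of_ne ht₂.1 ?_
    rintro rfl
    exact h02 hb0.symm
  have ht12 : t₁ ≠ t₂ := by
    rintro rfl
    exact h12 rfl
  refine ⟨{ toJordanDomain := J'
            mark := ![0, min t₁ t₂, max t₁ t₂]
            strictMono_mark := ?_
            mark_mem := ?_ }, rfl, rfl, hb0, ?_⟩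
  · refine Fin.strictMono_iff_lt_succ.2 fun k => ?_
    fin_cases k
    · show (0 : ℝ) < min t₁ t₂
      exact lt_min ht₁0 ht₂0
    · show min t₁ t₂ < max t₁ t₂
      exact min_lt_max.2 ht12
  · intro k
    fin_cases k
    · show (0 : ℝ) ∈ Ico (0 : ℝ) 1
      exact ⟨le_rfl, zero_lt_one⟩
    · show min t₁ t₂ ∈ Ico (0 : ℝ) 1
      exact ⟨le_min ht₁0.le ht₂0.le, min_lt_of_left_lt ht₁.2⟩
    · show max t₁ t₂ ∈ Ico (0 : ℝ) 1
      exact ⟨le_max_of_le_left ht₁0.le, max_lt ht₁.2 ht₂.2⟩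
  · rcases le_or_gt t₁ t₂ with h | h
    · left
      constructor
      · show J'.boundary (min t₁ t₂) = J'.boundary t₁
        rw [min_eq_left h]
      · show J'.boundary (max t₁ t₂) = J'.boundary t₂
        rw [max_eq_right h]
    · right
      constructor
      · show J'.boundary (min t₁ t₂) = J'.boundary t₂
        rw [min_eq_right h.le]
      · show J'.boundary (max t₁ t₂) = J'.boundary t₁
        rw [max_eq_left h.le]

namespace MarkedDomain

/-- **The arc `[pt 1, pt 2]` of a `3`-marked domain re-based at `pt 0` is any sub-arc of `∂D`
through `pt 1`, `pt 2` missing `pt 0`**: if `A ⊆ ∂D` is closed and connected, misses `pt 0`,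
contains `pt 1` and `pt 2`, and stays connected after removing `pt 1` or `pt 2`, then
`D.arc 1 = A` (Newman 1939, Ch. IV §5). [folklore] -/
theorem arc_one_eq_of_mark_zero (M : MarkedDomain 3) (hM0 : M.mark 0 = 0) {A : Set ℂ}
    (hAc : IsClosed A) (hApre : IsPreconnected A) (hAfr : A ⊆ frontier M.carrier)
    (h0 : M.pt 0 ∉ A) (h1 : M.pt 1 ∈ A) (h2 : M.pt 2 ∈ A) (hA1 : IsPreconnected (A \ {M.pt 1}))
    (hA2 : IsPreconnected (A \ {M.pt 2})) : M.arc 1 = A := by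
  have h01 : 0 < M.mark 1 := by
    rw [← hM0]
    exact M.strictMono_mark (by decide)
  have h12 : M.mark 1 < M.mark 2 := M.strictMono_mark (by decide)
  have hnext : M.nextMark 1 = M.mark 2 := by
    simp only [MarkedDomain.nextMark]
    rfl
  have hβ1 : M.boundary 1 = M.boundary 0 := by
    have := M.periodic_boundary 0
    rwa [zero_add] at this
  have hAsub : A ⊆ M.boundary '' Ioo 0 1 := by
    intro x hx
    have hx' := hAfr hx
    rw [M.frontier_eq_image_Ico] at hx'
    obtain ⟨s, hs, rfl⟩ := hx'
    refine ⟨s, ⟨lt_of_le_of_ne hs.1 ?_, hs.2⟩, rfl⟩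
    rintro rfl
    apply h0
    show M.boundary (M.mark 0) ∈ A
    rw [hM0]
    exact hx
  have key := eq_image_Icc_of_loop M.continuous_boundary M.injOn_boundary hβ1 hAc hApre hAsub
    (tx := M.mark 1) (ty := M.mark 2) ⟨h01, (M.mark_mem 1).2⟩ ⟨h01.trans h12, (M.mark_mem 2).2⟩
    h12.ne h1 h2 hA1 hA2
  rw [key, min_eq_left h12.le, max_eq_right h12.le, MarkedDomain.arc, hnext]

/-! ### The arc `[b, b']` of a `3`-marked domain minus an endpoint -/

variable (D : MarkedDomain 3)

/-- The boundary loop is injective on the parameter interval `[mark 1, mark 2]` of the arc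
`[b, b']`. [folklore] -/
theorem injOn_boundary_Icc_mark_one : InjOn D.boundary (Icc (D.mark 1) (D.mark 2)) := by
  refine D.injOn_boundary.mono ?_
  intro s hs
  exact ⟨(D.mark_mem 1).1.trans hs.1, hs.2.trans_lt (D.mark_mem 2).2⟩

/-- Removing `b` from the closed arc `[b, b']` leaves the connected half-open arc `(b, b']`.
[folklore] -/
theorem isPreconnected_arc_one_diff_pt_one : IsPreconnected (D.arc 1 \ {D.pt 1}) := by
  have h12 : D.mark 1 < D.mark 2 := D.strictMono_mark (by decide)
  have hnext : D.nextMark 1 = D.mark 2 := by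
    simp only [MarkedDomain.nextMark]
    rfl
  have : D.arc 1 \ {D.pt 1} = D.boundary '' Ioc (D.mark 1) (D.mark 2) := by
    rw [MarkedDomain.arc, hnext, ← Icc_sdiff_left,
      (injOn_boundary_Icc_mark_one D).image_sdiff_subset
        (singleton_subset_iff.2 (left_mem_Icc.2 h12.le)), image_singleton]
    rfl
  rw [this]
  exact isPreconnected_Ioc.image _ D.continuous_boundary.continuousOn

/-- Removing `b'` from the closed arc `[b, b']` leaves the connected half-open arc `[b, b')`.
[folklore] -/
theorem isPreconnected_arc_one_diff_pt_two : IsPreconnected (D.arc 1 \ {D.pt 2}) := by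
  have h12 : D.mark 1 < D.mark 2 := D.strictMono_mark (by decide)
  have hnext : D.nextMark 1 = D.mark 2 := by
    simp only [MarkedDomain.nextMark]
    rfl
  have : D.arc 1 \ {D.pt 2} = D.boundary '' Ico (D.mark 1) (D.mark 2) := by
    rw [MarkedDomain.arc, hnext, ← Icc_sdiff_right,
      (injOn_boundary_Icc_mark_one D).image_sdiff_subset
        (singleton_subset_iff.2 (right_mem_Icc.2 h12.le)), image_singleton]
    rfl
  rw [this]
  exact isPreconnected_Ico.image _ D.continuous_boundary.continuousOn

end MarkedDomain

end Literature.Probability.RandomPlanarGeometry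

end
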